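import Literature.Topology.FourManifolds.TubeSurgery
import Literature.Topology.FourManifolds.RegularLevelSet
import Literature.Topology.FourManifolds.SeifertCircleMap
import Literature.Topology.FourManifolds.PlanarArch
import Mathlib.Analysis.InnerProductSpace.Calculus
import Mathlib.Analysis.SpecialFunctions.SmoothTransition
import Mathlib.Geometry.Manifold.Algebra.Structures
import HarnessLib

/-!
# The closed-up level surface of the circle-valued map of a knot complement

Topic `Literature/Topology/FourManifolds`; fact seat
`provefact-Literature.Topology.FourManifolds.Knot.sliceGenus_eq_zero_iff`, glue step G2 of the
transversality construction of Seifert surfaces (Juhász, *Differential and Low-Dimensional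
Topology* (2023), proof of Prop. 4.10: "`1 ∈ S¹` is a regular value … `f⁻¹({1})` … extends in
`N(L)` to a compact, connected, oriented manifold with boundary `L`"). Everything here is
**proved**.

**Data** (`Literature.Topology.FourManifolds.SeifertDatum K`): an oriented tubular neighbourhood
`ν : 𝕊¹ × ℝ² ↪ 𝕊³` of the knot `K`, a `C^∞` map `θ : S³ ∖ K → 𝕊¹` which is the fibre angle
`w / ‖w‖` on the punctured closed unit tube (the named fact
`Knot.exists_circleMap_eq_angle_of_hasFraming_zero`, `SeifertCircleMap.lean`), and a point
`v ∈ 𝕊¹` such that `θ` has no critical point over `v` or over `-v` (`CircleMapRegularValues.lean`,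
from Sard's theorem).

**The surface.** `Λ = K ∪ θ⁻¹{v, -v} ⊆ 𝕊³` (`SeifertDatum.sheet`). Inside the open unit tube
`ν(𝕊¹ × B₁)` it is the annulus `{ν(x, s v) | |s| < 1}` through the knot (`mem_sheet_iff_of_mem_tube`:
`w / ‖w‖ = ±v` or `w = 0` iff `⟪w, Jv⟫ = 0`, `J` the rotation by a right angle), the zero set of
the smooth function `G = cut(‖w‖²) ⟪w, Jv⟫` (`tubeFn`), regular there; away from the knot it is
the zero set of `F = χ ⟪θ, Jv⟫` (`sheetFn`, `χ` a cutoff vanishing near `K`), regular at the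
points of `θ⁻¹{±v}` because `dθ` is onto there and `d(𝕊¹ ↪ ℝ²)_{±v}` has range `ℝ Jv`
(Mathlib `range_mfderiv_coe_sphere`). The regular value theorem in its chart form
(`Literature.Topology.FourManifolds.exists_sliceChart`, `RegularLevelSet.lean`; Hirsch 1976,
Ch. 1 §3 Thm. 3.2) therefore provides slice charts of `𝕊³` along `Λ`
(`SeifertDatum.sliceChartFamily`), and `SliceCharts.lean` (Lee 2013, Thm. 5.8) makes `Λ` a
`C^∞` surface without boundary, `SeifertDatum.Sheet`, smoothly embedded in `𝕊³`. The Seifert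
surface itself — the half `K ∪ θ⁻¹{v}` of `Λ`, a regular domain in it bounded by `K` — is cut out
in the sibling file.

Also proved: smooth maps into a slice submanifold (`SliceChartFamily.contMDiffAt_codRestrict`,
Lee 2013, Cor. 5.30; the analogue for `SliceChartFamily` of the tree's
`HalfSliceAtlas.contMDiffAt_codRestrict`).

## References

* A. Juhász, *Differential and Low-Dimensional Topology* (2023), proof of Prop. 4.10.
  [Juhasz2023]
* M. W. Hirsch, *Differential Topology* (1976), Ch. 1 §3 Thm. 3.2, §4 Thm. 4.1 (regular
  values, neat submanifolds). [HirschDT1976]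
* J. M. Lee, *Introduction to Smooth Manifolds*, 2nd ed. (2013), Thm. 5.8, Cor. 5.14,
  Cor. 5.30. [LeeSmoothManifolds2013]
-/

open scoped Manifold ContDiff Topology RealInnerProductSpace
open Function Set Filter

noncomputable section

namespace Literature.Topology.FourManifolds

/-- Local notation: `𝔼 n` is the model Euclidean space `EuclideanSpace ℝ (Fin n)`. -/
local notation "𝔼 " n:arg => EuclideanSpace ℝ (Fin n)

/-- Local notation: `𝕊 n` is the unit sphere in `EuclideanSpace ℝ (Fin (n + 1))`. -/
local notation "𝕊 " n:arg => (Metric.sphere (0 : EuclideanSpace ℝ (Fin (n + 1))) 1)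

/-! ### Plane geometry: the rotation by a right angle -/

/-- The inner product of `ℝ²` in coordinates. [folklore] -/
theorem inner_fin_two (a b : 𝔼 2) : ⟪a, b⟫ = a 0 * b 0 + a 1 * b 1 := by
  rw [PiLp.inner_apply, Fin.sum_univ_two]
  simp [RCLike.inner_apply, mul_comm]

/-! The rotation `J` of `ℝ²` by a right angle is the tree's `quarterRot`
(`DehnSurgeryTwistProofs.lean`): `quarterRot w = (-w 1, w 0)`. -/

/-- `⟪v, Jv⟫ = 0`. [folklore] -/
@[simp] theorem inner_self_quarterRot (v : 𝔼 2) : ⟪v, quarterRot v⟫ = 0 := by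
  rw [inner_fin_two]; simp; ring

/-- `⟪Jv, Jv⟫ = ⟪v, v⟫`. [folklore] -/
theorem inner_quarterRot_quarterRot (v : 𝔼 2) : ⟪quarterRot v, quarterRot v⟫ = ⟪v, v⟫ := by
  rw [inner_fin_two, inner_fin_two]; simp; ring

/-- **Expansion in the orthonormal frame `(v, Jv)`** of a unit vector `v`:
`w = ⟪w, v⟫ v + ⟪w, Jv⟫ Jv`. [folklore] -/
theorem eq_inner_smul_add_inner_quarterRot_smul {v : 𝔼 2} (hv : ‖v‖ = 1) (w : 𝔼 2) :
    w = ⟪w, v⟫ • v + ⟪w, quarterRot v⟫ • quarterRot v := by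
  have h1 : v 0 * v 0 + v 1 * v 1 = 1 := by
    have := real_inner_self_eq_norm_sq v
    rw [hv, inner_fin_two] at this; linarith
  ext i
  fin_cases i
  · simp [inner_fin_two]
    linear_combination (-(w 0)) * h1
  · simp [inner_fin_two]
    linear_combination (-(w 1)) * h1

/-- A vector orthogonal to `Jv` is a multiple of the unit vector `v`: `w = ⟪w, v⟫ v`. [folklore] -/
theorem eq_inner_smul_of_inner_quarterRot_eq_zero {v : 𝔼 2} (hv : ‖v‖ = 1) {w : 𝔼 2}
    (hw : ⟪w, quarterRot v⟫ = 0) : w = ⟪w, v⟫ • v := by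
  conv_lhs => rw [eq_inner_smul_add_inner_quarterRot_smul hv w, hw, zero_smul, add_zero]

/-- A vector orthogonal to both `v` and `Jv` (`v` a unit vector) vanishes. [folklore] -/
theorem eq_zero_of_inner_eq_zero_of_inner_quarterRot_eq_zero {v : 𝔼 2} (hv : ‖v‖ = 1) {w : 𝔼 2}
    (h1 : ⟪w, v⟫ = 0) (h2 : ⟪w, quarterRot v⟫ = 0) : w = 0 := by
  rw [eq_inner_smul_add_inner_quarterRot_smul hv w, h1, h2, zero_smul, zero_smul, add_zero]

/-- For a multiple `w = s v` of a unit vector: `⟪w, v⟫ = s` and `⟪w, Jv⟫ = 0`. [folklore] -/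
theorem inner_smul_unit {v : 𝔼 2} (hv : ‖v‖ = 1) (s : ℝ) :
    ⟪s • v, v⟫ = s ∧ ⟪s • v, quarterRot v⟫ = 0 := by
  constructor
  · rw [real_inner_smul_left, real_inner_self_eq_norm_sq, hv]; ring
  · rw [real_inner_smul_left, inner_self_quarterRot, mul_zero]

/-- **The fibre angle is `±v` iff the fibre vector is a nonzero multiple of `v`**: for `w ≠ 0`
and a unit vector `v`, `w / ‖w‖ ∈ {v, -v} ↔ ⟪w, Jv⟫ = 0`. [folklore] -/
theorem norm_inv_smul_eq_or_iff {v : 𝔼 2} (hv : ‖v‖ = 1) {w : 𝔼 2} (hw : w ≠ 0) :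
    (‖w‖⁻¹ • w = v ∨ ‖w‖⁻¹ • w = -v) ↔ ⟪w, quarterRot v⟫ = 0 := by
  have hn : ‖w‖ ≠ 0 := norm_ne_zero_iff.mpr hw
  constructor
  · rintro (h | h)
    · have : w = ‖w‖ • v := by
        rw [← h, smul_smul, mul_inv_cancel₀ hn, one_smul]
      rw [this]; exact (inner_smul_unit hv _).2
    · have : w = (-‖w‖) • v := by
        rw [neg_smul, ← smul_neg, ← h, smul_smul, mul_inv_cancel₀ hn, one_smul]
      rw [this]; exact (inner_smul_unit hv _).2
  · intro h
    have hw' := eq_inner_smul_of_inner_quarterRot_eq_zero hv h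
    set s := ⟪w, v⟫ with hs
    have hs0 : s ≠ 0 := by
      intro h0; apply hw; rw [hw', h0, zero_smul]
    have hnorm : ‖w‖ = |s| := by rw [hw', norm_smul, hv, mul_one, Real.norm_eq_abs]
    rcases lt_or_gt_of_ne hs0 with hneg | hpos
    · right
      rw [hnorm, abs_of_neg hneg, hw', smul_smul]
      rw [show (-s)⁻¹ * s = -1 by field_simp, neg_one_smul]
    · left
      rw [hnorm, abs_of_pos hpos]
      conv_lhs => rw [hw', smul_smul, inv_mul_cancel₀ hs0, one_smul]

/-- A unit vector `u` orthogonal to `Jv` with `⟪u, v⟫ > 0` is `v` (`v` a unit vector). [folklore] -/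
theorem eq_of_inner_quarterRot_eq_zero_of_inner_pos {v u : 𝔼 2} (hv : ‖v‖ = 1) (hu : ‖u‖ = 1)
    (h : ⟪u, quarterRot v⟫ = 0) (hp : 0 < ⟪u, v⟫) : u = v := by
  have hu' := eq_inner_smul_of_inner_quarterRot_eq_zero hv h
  have : ⟪u, v⟫ = 1 := by
    have hn : ‖u‖ = |⟪u, v⟫| := by
      conv_lhs => rw [hu', norm_smul, hv, mul_one, Real.norm_eq_abs]
    rw [hu, abs_of_pos hp] at hn
    exact hn.symm
  rw [hu', this, one_smul]

/-- A unit vector `u` orthogonal to `Jv` with `⟪u, v⟫ < 0` is `-v` (`v` a unit vector).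
[folklore] -/
theorem eq_neg_of_inner_quarterRot_eq_zero_of_inner_neg {v u : 𝔼 2} (hv : ‖v‖ = 1) (hu : ‖u‖ = 1)
    (h : ⟪u, quarterRot v⟫ = 0) (hneg : ⟪u, v⟫ < 0) : u = -v := by
  have hu' := eq_inner_smul_of_inner_quarterRot_eq_zero hv h
  have : ⟪u, v⟫ = -1 := by
    have hn : ‖u‖ = |⟪u, v⟫| := by
      conv_lhs => rw [hu', norm_smul, hv, mul_one, Real.norm_eq_abs]
    rw [hu, abs_of_neg hneg] at hn
    linarith
  rw [hu', this, neg_one_smul]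

/-! ### Smooth steps -/

/-! The smooth step up from `0` (on `r ≤ a`) to `1` (on `b ≤ r`) is the tree's `smoothStep a b`
(`PlanarArch.lean`, from Mathlib's `Real.smoothTransition`). -/

/-- The smooth **step down** from `1` (on `r ≤ a`) to `0` (on `b ≤ r`): `1 - smoothStep a b r`.
[folklore] -/
def stepDown (a b r : ℝ) : ℝ := 1 - smoothStep a b r

/-- The step down is `1` left of `a`. [folklore] -/
theorem stepDown_of_le {a b r : ℝ} (hab : a < b) (h : r ≤ a) : stepDown a b r = 1 := by
  rw [stepDown, smoothStep_of_le hab h, sub_zero]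

/-- The step down is `0` right of `b`. [folklore] -/
theorem stepDown_of_ge {a b r : ℝ} (hab : a < b) (h : b ≤ r) : stepDown a b r = 0 := by
  rw [stepDown, smoothStep_of_ge hab h, sub_self]

/-- The step down is smooth. [folklore] -/
theorem contDiff_stepDown (a b : ℝ) : ContDiff ℝ ∞ (stepDown a b) :=
  contDiff_const.sub (contDiff_smoothStep a b)

/-! ### The datum of the construction -/

/-- **Seifert datum** of a knot `K`: an oriented tubular neighbourhood `ν`, a `C^∞` circle-valued
map `θ` of the knot complement which is the fibre angle `w / ‖w‖` on the punctured closed unit tube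
of `ν` (Juhász 2023, proof of Prop. 4.10: `f_α|_{∂E}` is the projection `L × S¹ → S¹`; the named
fact `Knot.exists_circleMap_eq_angle_of_hasFraming_zero`), and a point `v ∈ 𝕊¹` over which, and
over whose antipode, `θ` has no critical point (a regular value and its antipode, Sard).
[cite: Juhasz2023, proof of Prop. 4.10] -/
structure SeifertDatum (K : Knot) where
  /-- The tubular neighbourhood. -/
  ν : Knot.TubularNbhd K
  /-- The circle-valued map of the knot complement. -/
  θ : K.complement → 𝕊 1
  /-- The regular value. -/
  v : 𝕊 1
  /-- `θ` is smooth. -/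
  contMDiff_θ : ContMDiff (𝓡 3) (𝓡 1) ∞ θ
  /-- On the punctured closed unit tube, `θ` is the fibre angle. -/
  θ_eq_angle : ∀ (x : 𝕊 1) (w : 𝔼 2) (hw : w ≠ 0), ‖w‖ ≤ 1 →
    ((θ ⟨ν (x, w), ν.apply_mem_compl_range hw⟩ : 𝕊 1) : 𝔼 2) = ‖w‖⁻¹ • w
  /-- `v` is a regular value of `θ`. -/
  mfderiv_ne_zero_of_eq : ∀ p, ((θ p : 𝕊 1) : 𝔼 2) = (v : 𝔼 2) → mfderiv (𝓡 3) (𝓡 1) θ p ≠ 0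
  /-- `-v` is a regular value of `θ`. -/
  mfderiv_ne_zero_of_eq_neg : ∀ p, ((θ p : 𝕊 1) : 𝔼 2) = -(v : 𝔼 2) →
    mfderiv (𝓡 3) (𝓡 1) θ p ≠ 0

namespace SeifertDatum

open scoped Classical

variable {K : Knot} (D : SeifertDatum K)

/-- `v` is a unit vector. [folklore] -/
theorem norm_v : ‖(D.v : 𝔼 2)‖ = 1 := norm_eq_of_mem_sphere D.v

/-- `v ≠ 0`. [folklore] -/
theorem v_ne_zero : (D.v : 𝔼 2) ≠ 0 := ne_zero_of_mem_unit_sphere D.v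

/-! ### Tube coordinates -/

/-- The **fibre coordinate** `w` of a point of the tube, `fib (ν (x, w)) = w` (junk off the
tube). [folklore] -/
def fib (p : 𝕊 3) : 𝔼 2 := (D.ν.toTubeNbhd.toHomeo.symm p).2

/-- `fib (ν (x, w)) = w`. [folklore] -/
@[simp] theorem fib_apply (x : 𝕊 1) (w : 𝔼 2) : D.fib (D.ν (x, w)) = w := by
  rw [fib, ← Knot.TubularNbhd.toTubeNbhd_toFun, TubeNbhd.toHomeo_symm_apply]

/-- The fibre coordinate is smooth on the tube. [folklore] -/
theorem contMDiffOn_fib : ContMDiffOn (𝓡 3) 𝓘(ℝ, 𝔼 2) ∞ D.fib (range ⇑D.ν) :=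
  contMDiff_snd.comp_contMDiffOn D.ν.toTubeNbhd.contMDiffOn_toHomeo_symm

/-- The range of the tube is open. [folklore] -/
theorem isOpen_range_ν : IsOpen (range ⇑D.ν) := D.ν.toTubeNbhd.isOpen_range

/-- The **open tube of radius `r`**, `ν (𝕊¹ × B(0, r))`. [folklore] -/
def tubeSet (r : ℝ) : Set (𝕊 3) := ⇑D.ν '' (univ ×ˢ Metric.ball 0 r)

/-- The **closed tube of radius `r`**, `ν (𝕊¹ × B̄(0, r))`. [folklore] -/
def closedTubeSet (r : ℝ) : Set (𝕊 3) := ⇑D.ν '' (univ ×ˢ Metric.closedBall 0 r)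

/-- Open tubes are open (invariance of domain for `ν`). [folklore] -/
theorem isOpen_tubeSet (r : ℝ) : IsOpen (D.tubeSet r) :=
  D.ν.toTubeNbhd.isOpenEmbedding.isOpenMap _ (isOpen_univ.prod Metric.isOpen_ball)

/-- Closed tubes are compact. [folklore] -/
theorem isCompact_closedTubeSet (r : ℝ) : IsCompact (D.closedTubeSet r) :=
  (isCompact_univ.prod (isCompact_closedBall 0 r)).image D.ν.continuous

/-- Closed tubes are closed. [folklore] -/
theorem isClosed_closedTubeSet (r : ℝ) : IsClosed (D.closedTubeSet r) :=
  (D.isCompact_closedTubeSet r).isClosed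

/-- Membership of `ν (x, w)` in an open tube is `‖w‖ < r`. [folklore] -/
@[simp] theorem apply_mem_tubeSet_iff {r : ℝ} {x : 𝕊 1} {w : 𝔼 2} :
    D.ν (x, w) ∈ D.tubeSet r ↔ ‖w‖ < r := by
  constructor
  · rintro ⟨⟨x', w'⟩, ⟨-, hw'⟩, h⟩
    obtain ⟨rfl, rfl⟩ := Prod.ext_iff.mp (D.ν.injective h)
    simpa using hw'
  · intro h
    exact ⟨(x, w), ⟨mem_univ _, by simpa using h⟩, rfl⟩

/-- Membership of `ν (x, w)` in a closed tube is `‖w‖ ≤ r`. [folklore] -/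
@[simp] theorem apply_mem_closedTubeSet_iff {r : ℝ} {x : 𝕊 1} {w : 𝔼 2} :
    D.ν (x, w) ∈ D.closedTubeSet r ↔ ‖w‖ ≤ r := by
  constructor
  · rintro ⟨⟨x', w'⟩, ⟨-, hw'⟩, h⟩
    obtain ⟨rfl, rfl⟩ := Prod.ext_iff.mp (D.ν.injective h)
    simpa using hw'
  · intro h
    exact ⟨(x, w), ⟨mem_univ _, by simpa using h⟩, rfl⟩

/-- Open tubes lie in the range of `ν`. [folklore] -/
theorem tubeSet_subset_range (r : ℝ) : D.tubeSet r ⊆ range ⇑D.ν := image_subset_range _ _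

/-- Closed tubes lie in the range of `ν`. [folklore] -/
theorem closedTubeSet_subset_range (r : ℝ) : D.closedTubeSet r ⊆ range ⇑D.ν :=
  image_subset_range _ _

/-- The knot lies in every open tube of positive radius. [folklore] -/
theorem range_K_subset_tubeSet {r : ℝ} (hr : 0 < r) : range ⇑K ⊆ D.tubeSet r := by
  rintro _ ⟨x, rfl⟩
  rw [← D.ν.coe_apply_zero x, apply_mem_tubeSet_iff, norm_zero]
  exact hr

/-- A point of the range of `ν` is `ν (x, fib p)` for some `x`. [folklore] -/
theorem exists_eq_apply_of_mem_range {p : 𝕊 3} (hp : p ∈ range ⇑D.ν) :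
    ∃ x : 𝕊 1, p = D.ν (x, D.fib p) := by
  obtain ⟨⟨x, w⟩, rfl⟩ := hp
  exact ⟨x, by rw [fib_apply]⟩

/-! ### The circle-valued map, read in `ℝ²` and extended by `0` over the knot -/

/-- The map `θ` read in `ℝ²`, as a function on `𝕊³` (value `0` on the knot). [folklore] -/
def θhat (p : 𝕊 3) : 𝔼 2 :=
  if h : p ∈ range ⇑K then 0 else ((D.θ ⟨p, h⟩ : 𝕊 1) : 𝔼 2)

/-- `θhat` off the knot is `θ`. [folklore] -/
theorem θhat_of_not_mem {p : 𝕊 3} (h : p ∉ range ⇑K) : D.θhat p = ((D.θ ⟨p, h⟩ : 𝕊 1) : 𝔼 2) :=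
  dif_neg h

/-- `θhat` on the knot is the junk value `0`. [folklore] -/
theorem θhat_of_mem {p : 𝕊 3} (h : p ∈ range ⇑K) : D.θhat p = 0 := dif_pos h

/-- On the knot complement `θhat` is `θ` followed by the inclusion `𝕊¹ ↪ ℝ²`. [folklore] -/
theorem θhat_comp_val :
    (fun p : K.complement => D.θhat p) = fun p => ((D.θ p : 𝕊 1) : 𝔼 2) := by
  funext p
  exact D.θhat_of_not_mem p.2

/-- Off the knot, `θhat` is a unit vector. [folklore] -/
theorem norm_θhat {p : 𝕊 3} (h : p ∉ range ⇑K) : ‖D.θhat p‖ = 1 := by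
  rw [D.θhat_of_not_mem h]; exact norm_eq_of_mem_sphere _

/-- `θhat` is smooth off the knot. [folklore] -/
theorem contMDiffAt_θhat {p : 𝕊 3} (h : p ∉ range ⇑K) :
    ContMDiffAt (𝓡 3) 𝓘(ℝ, 𝔼 2) ∞ D.θhat p := by
  haveI : Fact (Module.finrank ℝ (𝔼 2) = 1 + 1) := ⟨by simp⟩
  have key : ContMDiffAt (𝓡 3) 𝓘(ℝ, 𝔼 2) ∞ (fun q : K.complement => D.θhat q) ⟨p, h⟩ := by
    rw [θhat_comp_val]
    exact ((contMDiff_coe_sphere (E := 𝔼 2) (n := 1)).comp D.contMDiff_θ) ⟨p, h⟩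
  exact (contMDiffAt_subtype_iff (U := K.complement) (x := ⟨p, h⟩)).mp key

/-- `θhat` is continuous on the knot complement. [folklore] -/
theorem continuousOn_θhat : ContinuousOn D.θhat (range ⇑K)ᶜ := fun _ hp =>
  (D.contMDiffAt_θhat hp).continuousAt.continuousWithinAt

/-- On the punctured closed unit tube `θhat` is the fibre angle. [folklore] -/
theorem θhat_tube (x : 𝕊 1) {w : 𝔼 2} (hw : w ≠ 0) (hw1 : ‖w‖ ≤ 1) :
    D.θhat (D.ν (x, w)) = ‖w‖⁻¹ • w := by
  rw [D.θhat_of_not_mem (D.ν.apply_mem_compl_range hw)]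
  exact D.θ_eq_angle x w hw hw1

/-! ### The closed-up level surface `Λ = K ∪ θ⁻¹{±v}` -/

/-- The **closed-up level surface** `Λ = K ∪ θ⁻¹{v, -v} ⊆ 𝕊³` of the datum (Juhász 2023, proof
of Prop. 4.10: the regular level `f⁻¹({1})` extended in `N(L)`; here doubled by the antipodal
level so as to be a surface *without* boundary through the knot). [cite: Juhasz2023, proof of Prop. 4.10] -/
def sheet : Set (𝕊 3) :=
  {p | p ∈ range ⇑K ∨ D.θhat p = (D.v : 𝔼 2) ∨ D.θhat p = -(D.v : 𝔼 2)}

/-- Unfolding lemma for `Λ`. [folklore] -/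
theorem mem_sheet_iff {p : 𝕊 3} :
    p ∈ D.sheet ↔ p ∈ range ⇑K ∨ D.θhat p = (D.v : 𝔼 2) ∨ D.θhat p = -(D.v : 𝔼 2) :=
  Iff.rfl

/-- The knot lies on `Λ`. [folklore] -/
theorem range_K_subset_sheet : range ⇑K ⊆ D.sheet := fun _ h => Or.inl h

/-- **`Λ` inside the unit tube is the annulus `{ν(x, s v)}`**: for `‖w‖ < 1`,
`ν (x, w) ∈ Λ ↔ ⟪w, Jv⟫ = 0`. [folklore] -/
theorem apply_mem_sheet_iff (x : 𝕊 1) {w : 𝔼 2} (hw1 : ‖w‖ ≤ 1) :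
    D.ν (x, w) ∈ D.sheet ↔ ⟪w, quarterRot (D.v : 𝔼 2)⟫ = 0 := by
  by_cases hw : w = 0
  · subst hw
    simp only [inner_zero_left, iff_true]
    exact Or.inl ⟨x, (D.ν.coe_apply_zero x).symm⟩
  · rw [mem_sheet_iff, D.θhat_tube x hw hw1, ← norm_inv_smul_eq_or_iff D.norm_v hw]
    have hK : D.ν (x, w) ∉ range ⇑K := D.ν.apply_mem_compl_range hw
    simp [hK]

/-! ### The tube function `G` -/

/-- **The tube function** `G = cut(‖w‖²) ⟪w, Jv⟫` on the tube (`cut = 1` for `‖w‖ ≤ 1`, `0` for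
`‖w‖ ≥ 2`), `0` off it: a smooth real function on `𝕊³` whose zero set inside the unit tube is
`Λ`. [folklore] -/
def tubeFn (p : 𝕊 3) : ℝ :=
  if p ∈ range ⇑D.ν then stepDown 1 4 (‖D.fib p‖ ^ 2) * ⟪D.fib p, quarterRot (D.v : 𝔼 2)⟫ else 0

/-- `G (ν (x, w)) = cut(‖w‖²) ⟪w, Jv⟫`. [folklore] -/
theorem tubeFn_apply (x : 𝕊 1) (w : 𝔼 2) :
    D.tubeFn (D.ν (x, w)) = stepDown 1 4 (‖w‖ ^ 2) * ⟪w, quarterRot (D.v : 𝔼 2)⟫ := by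
  rw [tubeFn, if_pos (mem_range_self _), fib_apply]

/-- On the closed unit tube `G (ν (x, w)) = ⟪w, Jv⟫`. [folklore] -/
theorem tubeFn_apply_of_norm_le_one (x : 𝕊 1) {w : 𝔼 2} (hw : ‖w‖ ≤ 1) :
    D.tubeFn (D.ν (x, w)) = ⟪w, quarterRot (D.v : 𝔼 2)⟫ := by
  rw [tubeFn_apply, stepDown_of_le (by norm_num) (by nlinarith [norm_nonneg w]), one_mul]

/-- Off the closed tube of radius `2`, `G = 0`. [folklore] -/
theorem tubeFn_eq_zero_of_not_mem {p : 𝕊 3} (hp : p ∉ D.closedTubeSet 2) : D.tubeFn p = 0 := by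
  by_cases hr : p ∈ range ⇑D.ν
  · obtain ⟨⟨x, w⟩, rfl⟩ := hr
    rw [apply_mem_closedTubeSet_iff, not_le] at hp
    rw [tubeFn_apply, stepDown_of_ge (by norm_num) (by nlinarith), zero_mul]
  · rw [tubeFn, if_neg hr]

/-- **`G` is smooth on `𝕊³`.** [folklore] -/
theorem contMDiff_tubeFn : ContMDiff (𝓡 3) 𝓘(ℝ, ℝ) ∞ D.tubeFn := by
  intro p
  by_cases hp : p ∈ range ⇑D.ν
  · -- on the open tube, `G` is a smooth expression in the fibre coordinate
    have hform : ContMDiffOn (𝓡 3) 𝓘(ℝ, ℝ) ∞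
        (fun q => stepDown 1 4 (‖D.fib q‖ ^ 2) * ⟪D.fib q, quarterRot (D.v : 𝔼 2)⟫) (range ⇑D.ν) := by
      have h1 : ContDiff ℝ ∞ fun w : 𝔼 2 => stepDown 1 4 (‖w‖ ^ 2) * ⟪w, quarterRot (D.v : 𝔼 2)⟫ :=
        ((contDiff_stepDown 1 4).comp (contDiff_norm_sq ℝ)).mul (contDiff_id.inner ℝ contDiff_const)
      exact h1.contMDiff.comp_contMDiffOn D.contMDiffOn_fib
    have heq : EqOn D.tubeFn
        (fun q => stepDown 1 4 (‖D.fib q‖ ^ 2) * ⟪D.fib q, quarterRot (D.v : 𝔼 2)⟫) (range ⇑D.ν) :=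
      fun q hq => by rw [tubeFn, if_pos hq]
    exact ((hform.congr heq).contMDiffAt (D.isOpen_range_ν.mem_nhds hp))
  · -- off the closed tube of radius 2, `G = 0`
    have hp2 : p ∉ D.closedTubeSet 2 := fun h => hp (D.closedTubeSet_subset_range 2 h)
    have hev : D.tubeFn =ᶠ[𝓝 p] fun _ => 0 := by
      filter_upwards [(D.isClosed_closedTubeSet 2).isOpen_compl.mem_nhds hp2] with q hq
      exact D.tubeFn_eq_zero_of_not_mem hq
    exact contMDiffAt_const.congr_of_eventuallyEq hev

/-! ### The cutoff `χ` vanishing near the knot, and the sheet function `F` -/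

/-- **The cutoff near the knot**: `χ = step(‖w‖²)` on the tube (`0` for `‖w‖ ≤ 1/4`, `1` for
`‖w‖ ≥ 1/2`), `1` off it. [folklore] -/
def cutK (p : 𝕊 3) : ℝ :=
  if p ∈ range ⇑D.ν then smoothStep (1 / 16) (1 / 4) (‖D.fib p‖ ^ 2) else 1

/-- `χ (ν (x, w)) = step(‖w‖²)`. [folklore] -/
theorem cutK_apply (x : 𝕊 1) (w : 𝔼 2) :
    D.cutK (D.ν (x, w)) = smoothStep (1 / 16) (1 / 4) (‖w‖ ^ 2) := by
  rw [cutK, if_pos (mem_range_self _), fib_apply]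

/-- Off the closed tube of radius `1/2`, `χ = 1`. [folklore] -/
theorem cutK_eq_one_of_not_mem {p : 𝕊 3} (hp : p ∉ D.closedTubeSet (1 / 2)) : D.cutK p = 1 := by
  by_cases hr : p ∈ range ⇑D.ν
  · obtain ⟨⟨x, w⟩, rfl⟩ := hr
    rw [apply_mem_closedTubeSet_iff, not_le] at hp
    rw [cutK_apply, smoothStep_of_ge (by norm_num) (by nlinarith)]
  · rw [cutK, if_neg hr]

/-- On the open tube of radius `1/4`, `χ = 0`. [folklore] -/
theorem cutK_eq_zero_of_mem {p : 𝕊 3} (hp : p ∈ D.tubeSet (1 / 4)) : D.cutK p = 0 := by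
  obtain ⟨⟨x, w⟩, ⟨-, hw⟩, rfl⟩ := hp
  have hw' : ‖w‖ < 1 / 4 := by simpa using hw
  rw [cutK_apply, smoothStep_of_le (by norm_num) (by nlinarith [norm_nonneg w])]

/-- **`χ` is smooth on `𝕊³`.** [folklore] -/
theorem contMDiff_cutK : ContMDiff (𝓡 3) 𝓘(ℝ, ℝ) ∞ D.cutK := by
  intro p
  by_cases hp : p ∈ range ⇑D.ν
  · have hform : ContMDiffOn (𝓡 3) 𝓘(ℝ, ℝ) ∞
        (fun q => smoothStep (1 / 16) (1 / 4) (‖D.fib q‖ ^ 2)) (range ⇑D.ν) :=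
      ((contDiff_smoothStep _ _).comp (contDiff_norm_sq ℝ)).contMDiff.comp_contMDiffOn
        D.contMDiffOn_fib
    have heq : EqOn D.cutK (fun q => smoothStep (1 / 16) (1 / 4) (‖D.fib q‖ ^ 2)) (range ⇑D.ν) :=
      fun q hq => by rw [cutK, if_pos hq]
    exact (hform.congr heq).contMDiffAt (D.isOpen_range_ν.mem_nhds hp)
  · have hp2 : p ∉ D.closedTubeSet (1 / 2) := fun h => hp (D.closedTubeSet_subset_range _ h)
    have hev : D.cutK =ᶠ[𝓝 p] fun _ => 1 := by
      filter_upwards [(D.isClosed_closedTubeSet (1 / 2)).isOpen_compl.mem_nhds hp2] with q hq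
      exact D.cutK_eq_one_of_not_mem hq
    exact contMDiffAt_const.congr_of_eventuallyEq hev

/-- **The sheet function** `F = χ ⟪θ, Jv⟫`: a smooth real function on `𝕊³` whose zero set away
from the knot and near `θ⁻¹{±v}` is `Λ`. [folklore] -/
def sheetFn (p : 𝕊 3) : ℝ := D.cutK p * ⟪D.θhat p, quarterRot (D.v : 𝔼 2)⟫

/-- On the open tube of radius `1/4`, `F = 0`. [folklore] -/
theorem sheetFn_eq_zero_of_mem {p : 𝕊 3} (hp : p ∈ D.tubeSet (1 / 4)) : D.sheetFn p = 0 := by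
  rw [sheetFn, D.cutK_eq_zero_of_mem hp, zero_mul]

/-- Off the closed tube of radius `1/2`, `F = ⟪θ, Jv⟫`. [folklore] -/
theorem sheetFn_eq_of_not_mem {p : 𝕊 3} (hp : p ∉ D.closedTubeSet (1 / 2)) :
    D.sheetFn p = ⟪D.θhat p, quarterRot (D.v : 𝔼 2)⟫ := by
  rw [sheetFn, D.cutK_eq_one_of_not_mem hp, one_mul]

/-- **`F` is smooth on `𝕊³`.** [folklore] -/
theorem contMDiff_sheetFn : ContMDiff (𝓡 3) 𝓘(ℝ, ℝ) ∞ D.sheetFn := by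
  intro p
  by_cases hp : p ∈ range ⇑K
  · -- near the knot, `F = 0`
    have hev : D.sheetFn =ᶠ[𝓝 p] fun _ => 0 := by
      filter_upwards [(D.isOpen_tubeSet (1 / 4)).mem_nhds
        (D.range_K_subset_tubeSet (by norm_num) hp)] with q hq
      exact D.sheetFn_eq_zero_of_mem hq
    exact contMDiffAt_const.congr_of_eventuallyEq hev
  · have h2 : ContMDiffAt (𝓡 3) 𝓘(ℝ, ℝ) ∞ (fun q => ⟪D.θhat q, quarterRot (D.v : 𝔼 2)⟫) p :=
      ((contDiff_id.inner ℝ contDiff_const).contMDiff (n := ∞)).contMDiffAt.comp p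
        (D.contMDiffAt_θhat hp)
    exact (D.contMDiff_cutK p).mul h2

end SeifertDatum

namespace SeifertDatum

open scoped Classical

variable {K : Knot} (D : SeifertDatum K)

/-! ### Regularity of the tube function on the unit tube -/

/-- **`G` is regular on the open unit tube**: the composite `G ∘ ν` is `(x, w) ↦ ⟪w, Jv⟫` there,
whose differential in the fibre direction `Jv` is `‖Jv‖² = 1`; by the chain rule `dG ≠ 0`.
[folklore] -/
theorem not_isMCriticalPt_tubeFn (x : 𝕊 1) {w : 𝔼 2} (hw : ‖w‖ < 1) :
    ¬ IsMCriticalPt (𝓡 3) D.tubeFn (D.ν (x, w)) := by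
  intro hcrit
  set c : 𝔼 2 := quarterRot (D.v : 𝔼 2) with hc
  -- the composite with `ν` near `(x, w)` is `⟪c, ·⟫ ∘ snd`
  set g : (𝕊 1) × (𝔼 2) → ℝ := fun q => D.tubeFn (D.ν q) with hg
  have hgeq : g =ᶠ[𝓝 (x, w)] ((⇑(innerSL ℝ c)) ∘ Prod.snd) := by
    have hopen : IsOpen {q : (𝕊 1) × (𝔼 2) | ‖q.2‖ < 1} :=
      isOpen_lt (continuous_norm.comp continuous_snd) continuous_const
    filter_upwards [hopen.mem_nhds (show ‖(x, w).2‖ < 1 from hw)] with q hq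
    rw [hg]
    show D.tubeFn (D.ν (q.1, q.2)) = innerSL ℝ c q.2
    rw [D.tubeFn_apply_of_norm_le_one q.1 (le_of_lt hq), innerSL_apply_apply, real_inner_comm]
  have hνd : MDifferentiableAt ((𝓡 1).prod 𝓘(ℝ, 𝔼 2)) (𝓡 3) (⇑D.ν) (x, w) :=
    (D.ν.contMDiff (x, w)).mdifferentiableAt (by simp)
  have hGd : MDifferentiableAt (𝓡 3) 𝓘(ℝ, ℝ) D.tubeFn (D.ν (x, w)) :=
    (D.contMDiff_tubeFn _).mdifferentiableAt (by simp)
  have hld : MDifferentiableAt 𝓘(ℝ, 𝔼 2) 𝓘(ℝ, ℝ) (⇑(innerSL ℝ c)) w :=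
    ((innerSL ℝ c).contDiff.contMDiff (n := ∞)).mdifferentiableAt (by simp)
  -- the tangent vector `(0, c)` at `(x, w)`
  set V : TangentSpace ((𝓡 1).prod 𝓘(ℝ, 𝔼 2)) (x, w) := ((0 : 𝔼 1), c) with hV
  -- `dg (0, c) = 0` by the chain rule and criticality
  have hA : mfderiv ((𝓡 1).prod 𝓘(ℝ, 𝔼 2)) 𝓘(ℝ, ℝ) g (x, w) V = 0 := by
    rw [hg, show (fun q => D.tubeFn (D.ν q)) = D.tubeFn ∘ ⇑D.ν from rfl,
      mfderiv_comp (x, w) hGd hνd, hcrit]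
    rfl
  -- `d(⟪c, ·⟫ ∘ snd) (0, c) = ⟪c, c⟫`
  have hB : mfderiv ((𝓡 1).prod 𝓘(ℝ, 𝔼 2)) 𝓘(ℝ, ℝ) ((⇑(innerSL ℝ c)) ∘ Prod.snd) (x, w) V =
      ⟪c, c⟫ := by
    rw [mfderiv_comp (x, w) hld mdifferentiableAt_snd]
    show mfderiv 𝓘(ℝ, 𝔼 2) 𝓘(ℝ, ℝ) (⇑(innerSL ℝ c)) (x, w).2
      (mfderiv ((𝓡 1).prod 𝓘(ℝ, 𝔼 2)) 𝓘(ℝ, 𝔼 2) Prod.snd (x, w) V) = ⟪c, c⟫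
    rw [mfderiv_snd]
    show mfderiv 𝓘(ℝ, 𝔼 2) 𝓘(ℝ, ℝ) (⇑(innerSL ℝ c)) w c = ⟪c, c⟫
    rw [mfderiv_eq_fderiv, ContinuousLinearMap.fderiv]
    rfl
  -- compare along `g = ⟪c, ·⟫ ∘ snd` near `(x, w)`
  have hAB : mfderiv ((𝓡 1).prod 𝓘(ℝ, 𝔼 2)) 𝓘(ℝ, ℝ) g (x, w) V =
      mfderiv ((𝓡 1).prod 𝓘(ℝ, 𝔼 2)) 𝓘(ℝ, ℝ) ((⇑(innerSL ℝ c)) ∘ Prod.snd) (x, w) V :=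
    congrFun (congrArg DFunLike.coe hgeq.mfderiv_eq) V
  have hcc : (⟪c, c⟫ : ℝ) = 0 := hB.symm.trans (hAB.symm.trans hA)
  rw [hc, inner_quarterRot_quarterRot, real_inner_self_eq_norm_sq, D.norm_v] at hcc
  norm_num at hcc

/-! ### Regularity of the sheet function at the points of `θ⁻¹{±v}` away from the knot -/

/-- **`F` is regular at the points of `θ⁻¹{±v}` outside the closed tube of radius `1/2`**:
there `F = ⟪θ, Jv⟫` near the point; `dθ` is onto (`±v` are regular values), the differential of
`𝕊¹ ↪ ℝ²` at `±v` has range `ℝ Jv` (`range_mfderiv_coe_sphere`), so `d⟪θ, Jv⟫ ≠ 0`; the chain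
rule with the inclusion of the knot complement transfers this to `F` on `𝕊³`. [folklore] -/
theorem not_isMCriticalPt_sheetFn {p : 𝕊 3} (hK : p ∉ range ⇑K)
    (hp : p ∉ D.closedTubeSet (1 / 2))
    (hθ : D.θhat p = (D.v : 𝔼 2) ∨ D.θhat p = -(D.v : 𝔼 2)) :
    ¬ IsMCriticalPt (𝓡 3) D.sheetFn p := by
  intro hcrit
  haveI : Fact (Module.finrank ℝ (𝔼 2) = 1 + 1) := ⟨by simp⟩
  set c : 𝔼 2 := quarterRot (D.v : 𝔼 2) with hc
  set P : K.complement := ⟨p, hK⟩ with hP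
  -- the function `⟪θ, Jv⟫` on the knot complement
  set f₁ : K.complement → ℝ := fun q => ⟪((D.θ q : 𝕊 1) : 𝔼 2), c⟫ with hf₁
  have hθd : MDifferentiableAt (𝓡 3) (𝓡 1) D.θ P := (D.contMDiff_θ P).mdifferentiableAt (by simp)
  have hcoed : MDifferentiableAt (𝓡 1) 𝓘(ℝ, 𝔼 2) (Subtype.val : (𝕊 1) → 𝔼 2) (D.θ P) :=
    (contMDiff_coe_sphere (D.θ P)).mdifferentiableAt one_ne_zero
  have hℓd : MDifferentiableAt 𝓘(ℝ, 𝔼 2) 𝓘(ℝ, ℝ) (⇑(innerSL ℝ c)) ((D.θ P : 𝕊 1) : 𝔼 2) :=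
    ((innerSL ℝ c).contDiff.contMDiff (n := ∞)).mdifferentiableAt (by simp)
  -- (a) `mfderiv f₁ P ≠ 0`: there is `e` with `dθ e ≠ 0`, and then `df₁ e = ⟪c, u⟫ ≠ 0` for
  -- the nonzero vector `u = d(𝕊¹ ↪ ℝ²) (dθ e) ⊥ θ P = ±v`
  have hf₁_eq : f₁ = ((⇑(innerSL ℝ c)) ∘ (Subtype.val : (𝕊 1) → 𝔼 2)) ∘ D.θ := by
    funext q
    simp only [hf₁, comp_apply, innerSL_apply_apply, real_inner_comm]
  obtain ⟨e, he⟩ : ∃ e, mfderiv (𝓡 3) (𝓡 1) D.θ P e ≠ 0 := by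
    by_contra hall
    push Not at hall
    have h0 : mfderiv (𝓡 3) (𝓡 1) D.θ P = 0 := ContinuousLinearMap.ext hall
    rcases hθ with h | h
    · exact D.mfderiv_ne_zero_of_eq P (by rw [← D.θhat_of_not_mem hK]; exact h) h0
    · exact D.mfderiv_ne_zero_of_eq_neg P (by rw [← D.θhat_of_not_mem hK]; exact h) h0
  set u : 𝔼 2 := mfderiv (𝓡 1) 𝓘(ℝ, 𝔼 2) (Subtype.val : (𝕊 1) → 𝔼 2) (D.θ P)
    (mfderiv (𝓡 3) (𝓡 1) D.θ P e) with hu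
  have hu0 : u ≠ 0 := fun h0 =>
    he (mfderiv_coe_sphere_injective (n := 1) (D.θ P) (by rw [map_zero]; exact h0))
  have humem : u ∈ (ℝ ∙ ((D.θ P : 𝕊 1) : 𝔼 2))ᗮ := by
    rw [← range_mfderiv_coe_sphere (n := 1) (D.θ P)]
    exact ⟨_, rfl⟩
  rw [Submodule.mem_orthogonal_singleton_iff_inner_right] at humem
  have huv : ⟪u, (D.v : 𝔼 2)⟫ = 0 := by
    have hval : ((D.θ P : 𝕊 1) : 𝔼 2) = D.θhat p := (D.θhat_of_not_mem hK).symm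
    rw [hval] at humem
    rcases hθ with h | h
    · rw [h] at humem; rw [real_inner_comm]; exact humem
    · rw [h, inner_neg_left, neg_eq_zero] at humem; rw [real_inner_comm]; exact humem
  have huc : ⟪u, c⟫ ≠ 0 := fun h0 =>
    hu0 (eq_zero_of_inner_eq_zero_of_inner_quarterRot_eq_zero D.norm_v huv (by rw [← hc]; exact h0))
  have key : mfderiv (𝓡 3) 𝓘(ℝ, ℝ) f₁ P e = ⟪c, u⟫ := by
    rw [hf₁_eq, mfderiv_comp P (hℓd.comp _ hcoed) hθd]
    show mfderiv (𝓡 1) 𝓘(ℝ, ℝ) ((⇑(innerSL ℝ c)) ∘ (Subtype.val : (𝕊 1) → 𝔼 2)) (D.θ P)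
      (mfderiv (𝓡 3) (𝓡 1) D.θ P e) = ⟪c, u⟫
    rw [mfderiv_comp (D.θ P) hℓd hcoed]
    show mfderiv 𝓘(ℝ, 𝔼 2) 𝓘(ℝ, ℝ) (⇑(innerSL ℝ c)) ((D.θ P : 𝕊 1) : 𝔼 2) u = ⟪c, u⟫
    rw [mfderiv_eq_fderiv, ContinuousLinearMap.fderiv]
    rfl
  have hne : mfderiv (𝓡 3) 𝓘(ℝ, ℝ) f₁ P ≠ 0 := by
    intro h0
    rw [h0] at key
    exact huc (by rw [real_inner_comm]; exact key.symm)
  -- (b) near `P`, `F ∘ val = f₁`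
  have hFval : (fun q : K.complement => D.sheetFn q) =ᶠ[𝓝 P] f₁ := by
    have hopen : IsOpen ((Subtype.val : K.complement → 𝕊 3) ⁻¹' (D.closedTubeSet (1 / 2))ᶜ) :=
      (D.isClosed_closedTubeSet _).isOpen_compl.preimage continuous_subtype_val
    filter_upwards [hopen.mem_nhds (show (P : 𝕊 3) ∈ (D.closedTubeSet (1 / 2))ᶜ from hp)]
      with q hq
    rw [hf₁, D.sheetFn_eq_of_not_mem hq, D.θhat_of_not_mem q.2]
  -- (c) chain rule with the inclusion of the knot complement
  have hvald : MDifferentiableAt (𝓡 3) (𝓡 3) (Subtype.val : K.complement → 𝕊 3) P :=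
    (contMDiff_subtype_val (n := ∞) P).mdifferentiableAt (by simp)
  have hFd : MDifferentiableAt (𝓡 3) 𝓘(ℝ, ℝ) D.sheetFn p :=
    (D.contMDiff_sheetFn p).mdifferentiableAt (by simp)
  have hcomp : mfderiv (𝓡 3) 𝓘(ℝ, ℝ) (fun q : K.complement => D.sheetFn q) P = 0 := by
    rw [show (fun q : K.complement => D.sheetFn q) = D.sheetFn ∘ Subtype.val from rfl,
      mfderiv_comp P hFd hvald, hcrit]
    exact ContinuousLinearMap.zero_comp _
  exact hne (hFval.mfderiv_eq.symm.trans hcomp)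

/-! ### `Λ` away from the knot -/

/-- The knot lies in the closed tube of radius `1/2`. [folklore] -/
theorem range_K_subset_closedTubeSet : range ⇑K ⊆ D.closedTubeSet (1 / 2) := by
  rintro _ ⟨x, rfl⟩
  rw [← D.ν.coe_apply_zero x, apply_mem_closedTubeSet_iff, norm_zero]
  norm_num

/-- The open set `O₊ = {χ = 1} ∩ {⟪θ, v⟫ > 0}` around `θ⁻¹{v} ∖` tube. [folklore] -/
def posSet : Set (𝕊 3) :=
  (D.closedTubeSet (1 / 2))ᶜ ∩ (fun q => ⟪D.θhat q, (D.v : 𝔼 2)⟫) ⁻¹' Ioi 0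

/-- The open set `O₋ = {χ = 1} ∩ {⟪θ, v⟫ < 0}` around `θ⁻¹{-v} ∖` tube. [folklore] -/
def negSet : Set (𝕊 3) :=
  (D.closedTubeSet (1 / 2))ᶜ ∩ (fun q => ⟪D.θhat q, (D.v : 𝔼 2)⟫) ⁻¹' Iio 0

/-- `⟪θ, v⟫` is continuous off the closed tube of radius `1/2`. [folklore] -/
theorem continuousOn_inner_θhat :
    ContinuousOn (fun q => ⟪D.θhat q, (D.v : 𝔼 2)⟫) (D.closedTubeSet (1 / 2))ᶜ := by
  have hsub : (D.closedTubeSet (1 / 2))ᶜ ⊆ (range ⇑K)ᶜ :=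
    compl_subset_compl.mpr D.range_K_subset_closedTubeSet
  exact (D.continuousOn_θhat.mono hsub).inner continuousOn_const

/-- `O₊` is open. [folklore] -/
theorem isOpen_posSet : IsOpen D.posSet :=
  D.continuousOn_inner_θhat.isOpen_inter_preimage (D.isClosed_closedTubeSet _).isOpen_compl
    isOpen_Ioi

/-- `O₋` is open. [folklore] -/
theorem isOpen_negSet : IsOpen D.negSet :=
  D.continuousOn_inner_θhat.isOpen_inter_preimage (D.isClosed_closedTubeSet _).isOpen_compl
    isOpen_Iio

/-- **On `O₊`, `Λ` is the zero set of `F`.** [folklore] -/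
theorem mem_sheet_iff_of_mem_posSet {q : 𝕊 3} (hq : q ∈ D.posSet) :
    q ∈ D.sheet ↔ D.sheetFn q = 0 := by
  have hK : q ∉ range ⇑K := fun h => hq.1 (D.range_K_subset_closedTubeSet h)
  have hpos : 0 < ⟪D.θhat q, (D.v : 𝔼 2)⟫ := hq.2
  rw [D.sheetFn_eq_of_not_mem hq.1, mem_sheet_iff]
  constructor
  · rintro (h | h | h)
    · exact absurd h hK
    · rw [h, inner_self_quarterRot]
    · rw [h, inner_neg_left, inner_self_quarterRot, neg_zero]
  · intro h
    exact Or.inr (Or.inl (eq_of_inner_quarterRot_eq_zero_of_inner_pos D.norm_v (D.norm_θhat hK) h hpos))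

/-- **On `O₋`, `Λ` is the zero set of `F`.** [folklore] -/
theorem mem_sheet_iff_of_mem_negSet {q : 𝕊 3} (hq : q ∈ D.negSet) :
    q ∈ D.sheet ↔ D.sheetFn q = 0 := by
  have hK : q ∉ range ⇑K := fun h => hq.1 (D.range_K_subset_closedTubeSet h)
  have hneg : ⟪D.θhat q, (D.v : 𝔼 2)⟫ < 0 := hq.2
  rw [D.sheetFn_eq_of_not_mem hq.1, mem_sheet_iff]
  constructor
  · rintro (h | h | h)
    · exact absurd h hK
    · rw [h, inner_self_quarterRot]
    · rw [h, inner_neg_left, inner_self_quarterRot, neg_zero]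
  · intro h
    exact Or.inr (Or.inr
      (eq_neg_of_inner_quarterRot_eq_zero_of_inner_neg D.norm_v (D.norm_θhat hK) h hneg))

/-- **On the open unit tube, `Λ` is the zero set of `G`.** [folklore] -/
theorem mem_sheet_iff_of_mem_tubeSet {q : 𝕊 3} (hq : q ∈ D.tubeSet 1) :
    q ∈ D.sheet ↔ D.tubeFn q = 0 := by
  obtain ⟨⟨x, w⟩, ⟨-, hw⟩, rfl⟩ := hq
  have hw' : ‖w‖ < 1 := by simpa using hw
  rw [D.tubeFn_apply_of_norm_le_one x hw'.le, D.apply_mem_sheet_iff x hw'.le]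

/-! ### Slice charts along `Λ` -/

/-- Every point of `𝕊³` is an interior point (no boundary). [folklore] -/
theorem isInteriorPoint_sphere (q : 𝕊 3) : (𝓡 3).IsInteriorPoint q :=
  BoundarylessManifold.isInteriorPoint

/-- **Slice charts of `𝕊³` along `Λ` exist at every point of `Λ`** (the regular value theorem in
chart form, `Literature.Topology.FourManifolds.exists_sliceChart`, applied to `G` on the unit
tube and to `F` on `O±`, and restricted to these open sets). Hirsch (1976), Ch. 1 §3, Thm. 3.2;
Lee (2013), Cor. 5.14. [cite: HirschDT1976, Ch. 1 §3, Thm. 3.2] -/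
theorem exists_sliceChart_sheet (p : D.sheet) :
    ∃ ψ : OpenPartialHomeomorph (𝕊 3) (𝔼 3), ψ ∈ IsManifold.maximalAtlas (𝓡 3) ∞ (𝕊 3) ∧
      p.1 ∈ ψ.source ∧ (∀ q ∈ ψ.source, q ∈ D.sheet ↔ (𝓡 3) (ψ q) (Fin.last 2) = 0) ∧
      ∀ q ∈ ψ.source, (𝓡 3) (ψ q) ∈ interior (range (𝓡 3)) := by
  by_cases ht : p.1 ∈ D.tubeSet 1
  · -- inside the unit tube: the zero set of `G`
    obtain ⟨⟨x, w⟩, ⟨-, hw⟩, hxw⟩ := ht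
    have hw' : ‖w‖ < 1 := by simpa using hw
    have hreg : ¬ IsMCriticalPt (𝓡 3) D.tubeFn p.1 := by
      rw [← hxw]; exact D.not_isMCriticalPt_tubeFn x hw'
    obtain ⟨ψ, hψ, hpψ, hlast, hint⟩ :=
      exists_sliceChart (I := 𝓡 3) D.contMDiff_tubeFn (isInteriorPoint_sphere p.1) hreg
    have hG0 : D.tubeFn p.1 = 0 :=
      (D.mem_sheet_iff_of_mem_tubeSet (by rw [← hxw]; simpa using hw')).mp p.2
    refine ⟨ψ.restr (D.tubeSet 1), restr_mem_maximalAtlas _ hψ (D.isOpen_tubeSet 1), ?_, ?_, ?_⟩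
    · rw [OpenPartialHomeomorph.restr_source, (D.isOpen_tubeSet 1).interior_eq]
      exact ⟨hpψ, by rw [← hxw]; simpa using hw'⟩
    · intro q hq
      rw [OpenPartialHomeomorph.restr_source, (D.isOpen_tubeSet 1).interior_eq] at hq
      rw [OpenPartialHomeomorph.restr_apply, hlast q hq.1, hG0, sub_zero]
      exact D.mem_sheet_iff_of_mem_tubeSet hq.2
    · intro q hq
      rw [OpenPartialHomeomorph.restr_source] at hq
      rw [OpenPartialHomeomorph.restr_apply]
      exact hint q hq.1
  · -- outside the unit tube: the zero set of `F`, on `O₊` or `O₋`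
    have hK : p.1 ∉ range ⇑K := fun h => ht (D.range_K_subset_tubeSet one_pos h)
    have hp2 : p.1 ∉ D.closedTubeSet (1 / 2) := by
      intro h
      obtain ⟨⟨x, w⟩, ⟨-, hw⟩, hxw⟩ := h
      apply ht
      rw [← hxw, apply_mem_tubeSet_iff]
      have : ‖w‖ ≤ 1 / 2 := by simpa using hw
      linarith
    have hθ : D.θhat p.1 = (D.v : 𝔼 2) ∨ D.θhat p.1 = -(D.v : 𝔼 2) := by
      rcases p.2 with h | h | h
      · exact absurd h hK
      · exact Or.inl h
      · exact Or.inr h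
    have hreg : ¬ IsMCriticalPt (𝓡 3) D.sheetFn p.1 := D.not_isMCriticalPt_sheetFn hK hp2 hθ
    obtain ⟨ψ, hψ, hpψ, hlast, hint⟩ :=
      exists_sliceChart (I := 𝓡 3) D.contMDiff_sheetFn (isInteriorPoint_sphere p.1) hreg
    have hF0 : D.sheetFn p.1 = 0 := by
      rw [D.sheetFn_eq_of_not_mem hp2]
      rcases hθ with h | h
      · rw [h, inner_self_quarterRot]
      · rw [h, inner_neg_left, inner_self_quarterRot, neg_zero]
    rcases hθ with hpos | hneg
    · have hmem : p.1 ∈ D.posSet := ⟨hp2, by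
        show 0 < ⟪D.θhat p.1, (D.v : 𝔼 2)⟫
        rw [hpos, real_inner_self_eq_norm_sq, D.norm_v]; norm_num⟩
      refine ⟨ψ.restr D.posSet, restr_mem_maximalAtlas _ hψ D.isOpen_posSet, ?_, ?_, ?_⟩
      · rw [OpenPartialHomeomorph.restr_source, D.isOpen_posSet.interior_eq]
        exact ⟨hpψ, hmem⟩
      · intro q hq
        rw [OpenPartialHomeomorph.restr_source, D.isOpen_posSet.interior_eq] at hq
        rw [OpenPartialHomeomorph.restr_apply, hlast q hq.1, hF0, sub_zero]
        exact D.mem_sheet_iff_of_mem_posSet hq.2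
      · intro q hq
        rw [OpenPartialHomeomorph.restr_source] at hq
        rw [OpenPartialHomeomorph.restr_apply]
        exact hint q hq.1
    · have hmem : p.1 ∈ D.negSet := ⟨hp2, by
        show ⟪D.θhat p.1, (D.v : 𝔼 2)⟫ < 0
        rw [hneg, inner_neg_left, real_inner_self_eq_norm_sq, D.norm_v]; norm_num⟩
      refine ⟨ψ.restr D.negSet, restr_mem_maximalAtlas _ hψ D.isOpen_negSet, ?_, ?_, ?_⟩
      · rw [OpenPartialHomeomorph.restr_source, D.isOpen_negSet.interior_eq]
        exact ⟨hpψ, hmem⟩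
      · intro q hq
        rw [OpenPartialHomeomorph.restr_source, D.isOpen_negSet.interior_eq] at hq
        rw [OpenPartialHomeomorph.restr_apply, hlast q hq.1, hF0, sub_zero]
        exact D.mem_sheet_iff_of_mem_negSet hq.2
      · intro q hq
        rw [OpenPartialHomeomorph.restr_source] at hq
        rw [OpenPartialHomeomorph.restr_apply]
        exact hint q hq.1

/-- **The slice charts of `Λ`** (one at each point, `exists_sliceChart_sheet`), the datum from
which `SliceCharts.lean` builds the manifold structure (Lee 2013, Thm. 5.8).
[cite: LeeSmoothManifolds2013, Thm. 5.8] -/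
def sliceChartFamily : SliceChartFamily (𝓡 3) D.sheet where
  chart p := Classical.choose (D.exists_sliceChart_sheet p)
  mem_maximalAtlas p := (Classical.choose_spec (D.exists_sliceChart_sheet p)).1
  mem_source p := (Classical.choose_spec (D.exists_sliceChart_sheet p)).2.1
  mem_iff p := (Classical.choose_spec (D.exists_sliceChart_sheet p)).2.2.1
  mem_interior p := (Classical.choose_spec (D.exists_sliceChart_sheet p)).2.2.2

/-! ### The surface `Λ` as a type -/

/-- **The closed-up level surface `Λ` as a type**: the subtype `↥Λ` of `𝕊³`, on which the
smooth structure built from the slice charts is registered: a `C^∞` surface without boundary,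
Hausdorff, second countable, smoothly embedded in `𝕊³`. Lee (2013), Thm. 5.8 / Cor. 5.14.
[cite: LeeSmoothManifolds2013, Thm. 5.8 and Cor. 5.14] -/
def Sheet (D : SeifertDatum K) : Type := ↥D.sheet

namespace Sheet

/-- The subspace topology of `Λ ⊆ 𝕊³`. [folklore] -/
instance instTopologicalSpace : TopologicalSpace D.Sheet :=
  inferInstanceAs (TopologicalSpace ↥D.sheet)

/-- `Λ` is Hausdorff. [folklore] -/
instance instT2Space : T2Space D.Sheet := inferInstanceAs (T2Space ↥D.sheet)

/-- `Λ` is second countable. [folklore] -/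
instance instSecondCountableTopology : SecondCountableTopology D.Sheet :=
  inferInstanceAs (SecondCountableTopology ↥D.sheet)

/-- **The smooth structure of `Λ`, charts** (slice charts with the last coordinate dropped;
`SliceChartFamily.chartedSpace`). [cite: LeeSmoothManifolds2013, Thm. 5.8] -/
instance instChartedSpace : ChartedSpace (𝔼 2) D.Sheet := D.sliceChartFamily.chartedSpace

/-- **The smooth structure of `Λ`, compatibility** (`SliceChartFamily.isManifold`).
[cite: LeeSmoothManifolds2013, Thm. 5.8] -/
instance instIsManifold : IsManifold (𝓡 2) ∞ D.Sheet := D.sliceChartFamily.isManifold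

end Sheet

/-- The inclusion `Λ → 𝕊³`. [folklore] -/
def sheetIncl : D.Sheet → 𝕊 3 := Subtype.val

/-- The inclusion is the subtype coercion (definitional). [folklore] -/
@[simp] theorem sheetIncl_apply (p : D.Sheet) : D.sheetIncl p = p.1 := rfl

/-- Points of `Λ` lie on `Λ`. [folklore] -/
theorem sheetIncl_mem (p : D.Sheet) : D.sheetIncl p ∈ D.sheet := p.2

/-- The inclusion `Λ → 𝕊³` is injective. [folklore] -/
theorem sheetIncl_injective : Injective D.sheetIncl := Subtype.val_injective

/-- The preferred chart of `Λ` at `p` is the level chart of the chosen slice chart. [folklore] -/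
theorem chartAt_sheet_eq (p : D.Sheet) :
    chartAt (𝔼 2) p = D.sliceChartFamily.levelChart p := rfl

/-- **The inclusion `Λ ↪ 𝕊³` is a smooth embedding.** [cite: LeeSmoothManifolds2013, Thm. 5.8] -/
theorem isSmoothEmbedding_sheetIncl :
    Manifold.IsSmoothEmbedding (𝓡 2) (𝓡 3) ∞ D.sheetIncl :=
  D.sliceChartFamily.isSmoothEmbedding_subtype_val

/-- The inclusion `Λ ↪ 𝕊³` is an immersion. [cite: LeeSmoothManifolds2013, Thm. 5.8] -/
theorem isImmersion_sheetIncl : Manifold.IsImmersion (𝓡 2) (𝓡 3) ∞ D.sheetIncl :=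
  D.sliceChartFamily.isImmersion_subtype_val

/-- The inclusion `Λ ↪ 𝕊³` is smooth. [cite: LeeSmoothManifolds2013, Thm. 5.8] -/
theorem contMDiff_sheetIncl : ContMDiff (𝓡 2) (𝓡 3) ∞ D.sheetIncl :=
  D.sliceChartFamily.contMDiff_subtype_val

end SeifertDatum

/-! ### Smooth maps into a slice submanifold -/

namespace SliceChartFamily

universe u

variable {n : ℕ} {H : Type*} [TopologicalSpace H] {I : ModelWithCorners ℝ (𝔼 (n + 1)) H}
  {M : Type u} [TopologicalSpace M] [ChartedSpace H M] {S : Set M} (Ψ : SliceChartFamily I S)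
  {E' H' : Type*} [NormedAddCommGroup E'] [NormedSpace ℝ E'] [TopologicalSpace H']
  {J : ModelWithCorners ℝ E' H'} {N : Type*} [TopologicalSpace N] [ChartedSpace H' N]

/-- **A smooth map with values in a slice submanifold is smooth into the submanifold**
(pointwise form). If `g : N → M` is `C^∞` at `x` and `g(N) ⊆ S`, then `g : N → S` is `C^∞` at
`x` for the structure `Ψ.chartedSpace` of a family of slice charts: the extended chart of `S` at
`g x` is the slice chart there followed by "drop the last coordinate", so the map reads
`π ∘ I ∘ ψ ∘ g` near `x`. The analogue for `SliceChartFamily` of the tree's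
`HalfSliceAtlas.contMDiffAt_codRestrict` (`RegularDomainMaps.lean`). Lee, *Introduction to
Smooth Manifolds* (2013), Cor. 5.30. [cite: LeeSmoothManifolds2013, Cor. 5.30] -/
theorem contMDiffAt_codRestrict [IsManifold I ∞ M] {g : N → M} (hS : ∀ x, g x ∈ S) {x : N}
    (hg : ContMDiffAt J I ∞ g x) :
    letI := Ψ.chartedSpace
    ContMDiffAt J (𝓡 n) ∞ (S.codRestrict g hS) x := by
  letI := Ψ.chartedSpace
  haveI := Ψ.isManifold
  rw [contMDiffAt_iff_target]
  refine ⟨hg.continuousAt.codRestrict hS, ?_⟩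
  set p : S := S.codRestrict g hS x with hp
  have hψ : ContMDiffAt I I ∞ (Ψ.chart p) (g x) :=
    (contMDiffOn_of_mem_maximalAtlas (Ψ.mem_maximalAtlas p)).contMDiffAt
      ((Ψ.chart p).open_source.mem_nhds (Ψ.mem_source p))
  have hch : ContMDiffAt J 𝓘(ℝ, 𝔼 (n + 1)) ∞ (fun y => I (Ψ.chart p (g y))) x :=
    (ModelWithCorners.contMDiff I _).comp x (hψ.comp x hg)
  have hfst : ContMDiffAt J 𝓘(ℝ, 𝔼 n) ∞
      (fun y => ((snocEquiv n).symm (I (Ψ.chart p (g y)))).1) x :=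
    ((contDiff_snocEquiv_symm_fst n).contMDiff.contMDiffAt).comp x hch
  exact hfst.congr_of_eventuallyEq (Filter.Eventually.of_forall fun y => rfl)

/-- **A smooth map with values in a slice submanifold is smooth into the submanifold.**
Lee (2013), Cor. 5.30. [cite: LeeSmoothManifolds2013, Cor. 5.30] -/
theorem contMDiff_codRestrict [IsManifold I ∞ M] {g : N → M} (hS : ∀ x, g x ∈ S)
    (hg : ContMDiff J I ∞ g) :
    letI := Ψ.chartedSpace
    ContMDiff J (𝓡 n) ∞ (S.codRestrict g hS) := by
  letI := Ψ.chartedSpace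
  exact fun x => Ψ.contMDiffAt_codRestrict hS (hg x)

/-- A smooth map with values in a slice submanifold is smooth into the submanifold, on an
open set. Lee (2013), Cor. 5.30. [cite: LeeSmoothManifolds2013, Cor. 5.30] -/
theorem contMDiffOn_codRestrict [IsManifold I ∞ M] {g : N → M} (hS : ∀ x, g x ∈ S)
    {U : Set N} (hU : IsOpen U) (hg : ContMDiffOn J I ∞ g U) :
    letI := Ψ.chartedSpace
    ContMDiffOn J (𝓡 n) ∞ (S.codRestrict g hS) U := by
  letI := Ψ.chartedSpace
  exact fun x hx => (Ψ.contMDiffAt_codRestrict hS (hg.contMDiffAt (hU.mem_nhds hx))).contMDiffWithinAt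

end SliceChartFamily

namespace SeifertDatum

section ToSheet

variable {K : Knot} (D : SeifertDatum K) {N : Type*}

/-- A map into `𝕊³` with values in `Λ`, as a map into the surface `Λ`. [folklore] -/
def toSheet (g : N → 𝕊 3) (hS : ∀ x, g x ∈ D.sheet) : N → D.Sheet := fun x => ⟨g x, hS x⟩

/-- `incl ∘ toSheet g = g` (definitional). [folklore] -/
@[simp] theorem sheetIncl_toSheet (g : N → 𝕊 3) (hS : ∀ x, g x ∈ D.sheet) (x : N) :
    D.sheetIncl (D.toSheet g hS x) = g x := rfl

/-- `toSheet g x` is `g x` as a point of `𝕊³` (definitional). [folklore] -/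
@[simp] theorem toSheet_val (g : N → 𝕊 3) (hS : ∀ x, g x ∈ D.sheet) (x : N) :
    (D.toSheet g hS x).1 = g x := rfl

end ToSheet

variable {K : Knot} (D : SeifertDatum K)
  {E' H' : Type*} [NormedAddCommGroup E'] [NormedSpace ℝ E'] [TopologicalSpace H']
  {J : ModelWithCorners ℝ E' H'} {N : Type*} [TopologicalSpace N] [ChartedSpace H' N]

/-- **Smooth maps into `𝕊³` with values in `Λ` are smooth into `Λ`** (pointwise).
[cite: LeeSmoothManifolds2013, Cor. 5.30] -/
theorem contMDiffAt_toSheet {g : N → 𝕊 3} (hS : ∀ x, g x ∈ D.sheet) {x : N}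
    (hg : ContMDiffAt J (𝓡 3) ∞ g x) :
    ContMDiffAt J (𝓡 2) ∞ (D.toSheet g hS) x :=
  D.sliceChartFamily.contMDiffAt_codRestrict hS hg

/-- **Smooth maps into `𝕊³` with values in `Λ` are smooth into `Λ`.**
[cite: LeeSmoothManifolds2013, Cor. 5.30] -/
theorem contMDiff_toSheet {g : N → 𝕊 3} (hS : ∀ x, g x ∈ D.sheet)
    (hg : ContMDiff J (𝓡 3) ∞ g) :
    ContMDiff J (𝓡 2) ∞ (D.toSheet g hS) :=
  D.sliceChartFamily.contMDiff_codRestrict hS hg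

end SeifertDatum

end Literature.Topology.FourManifolds
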